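import Summits.AtomisticToContinuum.FouriersLaw.Theorems.PhononMeanFreePathIncoherentChannelTwoHorizonsCrux
import Summits.AtomisticToContinuum.FouriersLaw.Theorems.PhononMeanFreePathKuboFormFouriersLaw
import Summits.AtomisticToContinuum.FouriersLaw.Theorems.PhononMeanFreePathIncoherentChannelCommonPastBoundHelper2
import Summits.AtomisticToContinuum.FouriersLaw.Theorems.IncoherentChannel.Negative.LoadBearing

/-!
# Why line `two-horizons-forecast-loss` resists a cheap kill, and what its engine must deliver on ONE bath momentum (negative-side support)

Support lemmas for crux `PhononMeanFreePath.IncoherentChannel` (item stmt-AtomisticToContinuum-11811)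
from the standing disprover's work file `Cruxes/IncoherentChannel/Disproof.lean` §6 (gen 3), all
sorry-free, no new definitions:

* RESISTANCE. `NessUnique` (`NessUnique_holds`) and `BoundaryKubo` (`boundaryKubo_proof`) are now
  THEOREMS, so the conditional equivalence `LoadBearing.incoherentChannel_iff_fouriersLaw` becomes:
  coherent dephasing ALONE makes the crux equivalent to the sub-problem conjunct
  (`incoherentChannel_iff_fouriersLaw_of_coherentDephasing`); and since the lead's landed
  `coherentDephasing_of_forecastLoss` derives `CoherentDephasing` from the engine `stub_forecastLoss`,
  ONCE THE ENGINE IS PROVED the crux IS Fourier's law for the pinned anharmonic chain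
  (`incoherentChannel_iff_fouriersLaw_of_forecastLoss`). A disprover working on this line can
  therefore only attack the engine; every other kill is a disproof of the conjunct.
* NO COHERENT ECHO. What the engine must deliver on a single thermostatted coordinate:
  `a_N(t)² ≤ T·S_N(t)` for the end-momentum autocorrelation `a_N(t) = ⟨p_N, K_t p_N⟩_{μ_T}`
  (Cauchy–Schwarz, `‖p_N‖² = T`; `endAutocorr_sq_le_fnorm`), `S_N(0) = T` (`fnorm_zero`, so every
  envelope constant has `T ≤ C`, `envelope_const_ge`), hence the envelope forces the `N`-UNIFORM bound
  `a_N(t)² ≤ T·C·(1+t)^{-α}` (`endAutocorr_envelope_of_forecastEnvelope`) — an equilibrium two-time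
  function of one bath momentum, directly measurable by MD; at the harmonic corner the wave reflected by
  the far bath returns at `t ≈ 2N/v` and is exactly such an echo.
-/

noncomputable section

open MeasureTheory Filter Topology Set
open scoped NNReal
open Literature.MathematicalPhysics.KineticTheory.HeatConduction
open Literature.Probability.Process
open Summit.AtomisticToContinuum.FouriersLaw.Theses.PhononMeanFreePath
open Summit.AtomisticToContinuum.FouriersLaw.Theorems.PhononMeanFreePath
open Summit.AtomisticToContinuum.FouriersLaw.Theorems.PhononMeanFreePathBoundaryKubo (boundaryKubo_proof)
open Summit.AtomisticToContinuum.FouriersLaw.Theorems.IncoherentChannel.Negative.LoadBearing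
  (incoherentChannel_iff_fouriersLaw)

namespace Summit.AtomisticToContinuum.FouriersLaw.Theorems.IncoherentChannel.Negative.LineResistance

/-! ## Resistance: the residual content of the line is the conjunct -/

/-- **Coherent dephasing alone makes the crux EQUIVALENT to the sub-problem conjunct** (the sibling
items `NessUnique`, `BoundaryKubo` of `LoadBearing.incoherentChannel_iff_fouriersLaw` are theorems now).
[folklore] -/
theorem incoherentChannel_iff_fouriersLaw_of_coherentDephasing (hA : CoherentDephasing) :
    IncoherentChannel ↔ _root_.FouriersLaw :=
  incoherentChannel_iff_fouriersLaw NessUnique_holds boundaryKubo_proof hA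

/-- **Once the engine `stub_forecastLoss` of line `two-horizons-forecast-loss` is proved,
`IncoherentChannel ↔ FouriersLaw`.** [folklore] -/
theorem incoherentChannel_iff_fouriersLaw_of_forecastLoss
    (h₁ : ∀ ω₂ lam β γ : ℝ, 0 < ω₂ → 0 < lam → 0 < β → 0 < γ → ∀ T : ℝ, 0 < T →
      ∃ C α : ℝ, 2 < α ∧ ∀ (N : ℕ) (t : ℝ), 0 ≤ t → fnorm ω₂ lam β γ T N t ≤ C * (1 + t) ^ (-α)) :
    IncoherentChannel ↔ _root_.FouriersLaw :=
  incoherentChannel_iff_fouriersLaw_of_coherentDephasing (coherentDephasing_of_forecastLoss h₁)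

/-! ## What the engine must deliver on ONE bath momentum: no coherent echo -/

section Echo

variable {ω₂ lam β γ T : ℝ} (hω : 0 < ω₂) (hl : 0 ≤ lam) (hβ : 0 ≤ β) (hγ : 0 ≤ γ) (hT : 0 < T)
include hω hl hβ hγ hT

/-- **`a_N(t)² ≤ T · S_N(t)`** for the end-momentum autocorrelation `a_N(t) = ⟨p_N, K_t p_N⟩_{μ_T}`
(Cauchy–Schwarz in `L²(μ_T)`, `‖p_N‖²_{L²(μ_T)} = T`). [folklore] -/
theorem endAutocorr_sq_le_fnorm (N : ℕ) (t : ℝ) :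
    (∫ z, z.2 (Fin.last N) * fcast ω₂ lam β γ T N t z ∂((pinnedChain ω₂ lam β γ).gibbsMeasure (N + 1) T)) ^ 2 ≤
      T * fnorm ω₂ lam β γ T N t := by
  set μ₀ := (pinnedChain ω₂ lam β γ).gibbsMeasure (N + 1) T with hμ₀
  set i : Fin (N + 1) := Fin.last N with hi
  set v : PhaseSpace (N + 1) → ℝ := fun z => fcast ω₂ lam β γ T N t z with hv
  have hvm : Measurable v := commonPastBound_measurable_fcast_right hω hl hβ hγ N t
  have hI1 : Integrable (fun z : PhaseSpace (N + 1) => z.2 i ^ 2) μ₀ :=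
    commonPastBound_integrable_momentum_pow_gibbsMeasure hω hl hβ γ hT i 2
  have hI2 : Integrable (fun z => v z ^ 2) μ₀ := (commonPastBound_fnorm_le hω hl hβ hγ hT N t).1
  have hI3 : Integrable (fun z : PhaseSpace (N + 1) => z.2 i * v z) μ₀ := by
    refine ((hI1.add hI2).div_const 2).mono'
      (((measurable_pi_apply i).comp measurable_snd).mul hvm).aestronglyMeasurable
      (Eventually.of_forall fun z => ?_)
    rw [Real.norm_eq_abs, abs_mul]
    have := two_mul_le_add_sq |z.2 i| |v z|
    rw [sq_abs, sq_abs] at this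
    simp only [Pi.add_apply]
    linarith
  have hT1 : ∫ z : PhaseSpace (N + 1), z.2 i ^ 2 ∂μ₀ = T := by
    have h := commonPastBound_gibbs_even_moment hω hl hβ γ hT i 1
    simpa using h
  set r := ∫ z, z.2 i * v z ∂μ₀ with hr
  set S := fnorm ω₂ lam β γ T N t with hS
  have hS' : S = ∫ z, v z ^ 2 ∂μ₀ := rfl
  have key : ∀ a : ℝ, 0 ≤ a ^ 2 * T - 2 * a * r + S := by
    intro a
    have hnn : 0 ≤ ∫ z, (a * z.2 i - v z) ^ 2 ∂μ₀ := integral_nonneg fun z => sq_nonneg _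
    have e : (fun z : PhaseSpace (N + 1) => (a * z.2 i - v z) ^ 2) =
        fun z => (a ^ 2 * z.2 i ^ 2 - 2 * a * (z.2 i * v z)) + v z ^ 2 := by
      funext z; ring
    have hA : Integrable (fun z : PhaseSpace (N + 1) => a ^ 2 * z.2 i ^ 2 - 2 * a * (z.2 i * v z)) μ₀ :=
      (hI1.const_mul _).sub (hI3.const_mul _)
    rw [e, integral_add hA hI2, integral_sub (hI1.const_mul _) (hI3.const_mul _), integral_const_mul,
      integral_const_mul, hT1, ← hr, ← hS'] at hnn
    exact hnn
  have h := key (r / T)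
  have e : (r / T) ^ 2 * T - 2 * (r / T) * r + S = S - r ^ 2 / T := by
    field_simp
    ring
  rw [e, sub_nonneg, div_le_iff₀ hT] at h
  linarith

/-- `S_N(0) = T`: at time zero the forecast is `p_N` itself (`K_0 = id`). [folklore] -/
theorem fnorm_zero (N : ℕ) : fnorm ω₂ lam β γ T N 0 = T := by
  have hK : ∀ z : PhaseSpace (N + 1), fcast ω₂ lam β γ T N 0 z = z.2 (Fin.last N) := by
    intro z
    unfold fcast
    rw [Real.toNNReal_zero, pinnedChain_transitionKernel_zero hω hl hβ hγ, ProbabilityTheory.Kernel.id_apply,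
      integral_dirac]
  unfold fnorm
  simp_rw [hK]
  have h := commonPastBound_gibbs_even_moment hω hl hβ γ hT (Fin.last N : Fin (N + 1)) 1
  simpa using h

/-- Any envelope constant of `stub_forecastLoss` satisfies `T ≤ C` (no decay is asserted before it is
produced by the dynamics). [folklore] -/
theorem envelope_const_ge {C α : ℝ}
    (h : ∀ (N : ℕ) (t : ℝ), 0 ≤ t → fnorm ω₂ lam β γ T N t ≤ C * (1 + t) ^ (-α)) : T ≤ C := by
  have h0 := h 0 0 le_rfl
  rw [fnorm_zero hω hl hβ hγ hT 0] at h0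
  simpa using h0

/-- **NO COHERENT ECHO**: the engine forces the `N`-uniform, integrable-with-margin envelope
`a_N(t)² ≤ T·C·(1+t)^{-α}` on the squared autocorrelation of the bath momentum. [folklore] -/
theorem endAutocorr_envelope_of_forecastEnvelope {C α : ℝ}
    (h : ∀ (N : ℕ) (t : ℝ), 0 ≤ t → fnorm ω₂ lam β γ T N t ≤ C * (1 + t) ^ (-α)) (N : ℕ) {t : ℝ}
    (ht : 0 ≤ t) :
    (∫ z, z.2 (Fin.last N) * fcast ω₂ lam β γ T N t z ∂((pinnedChain ω₂ lam β γ).gibbsMeasure (N + 1) T)) ^ 2 ≤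
      T * C * (1 + t) ^ (-α) := by
  calc (∫ z, z.2 (Fin.last N) * fcast ω₂ lam β γ T N t z ∂((pinnedChain ω₂ lam β γ).gibbsMeasure (N + 1) T)) ^ 2
      ≤ T * fnorm ω₂ lam β γ T N t := endAutocorr_sq_le_fnorm hω hl hβ hγ hT N t
    _ ≤ T * (C * (1 + t) ^ (-α)) := mul_le_mul_of_nonneg_left (h N t ht) hT.le
    _ = T * C * (1 + t) ^ (-α) := by ring

end Echo

end Summit.AtomisticToContinuum.FouriersLaw.Theorems.IncoherentChannel.Negative.LineResistance

end
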